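import Summits.CriticalPhenomena.PercolationContinuityZ3.Theorems.PercNearOneGluingNoHeavyLowerTailSunflowerMinorPetalCube
import HarnessLib
import HarnessLib.Audit

/-!
# `NoHeavyLowerTail` (crux stmt-CriticalPhenomena-4575), abstract sunflower cubic: `MinorSuperadditivity` (DC) HOLDS AT EVERY PETAL POINT —
# part 2: the rainbow injection and the assembly

Support file (seat `prim-l12-p2` gen 20; `--supports stmt-CriticalPhenomena-4575`).  No `sorry`, no new definitions.
Memo: run/shared/lean/prim/prim-l12/prim-l12-p2/FINDING-g20-COMPLEMENT-READING.md §10.  Part 1: `…SunflowerMinorPetalCube`.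

Let `x ∈ W`, `W' = W ∖ {x}`, and `k := lab (C ∪ {x})` a petal (`k ∉ {0,4}`).
* `Sunflower.lab_insert_of_mem_block`, `sdiff_sdiff_blocks` — bookkeeping: in every rainbow of `(W;C)` the point `x` lies in the block labelled `k`.
* `Sunflower.minorRainbows_le_petal` — **RAINBOW INJECTION**: `N(W;C) ≤ N(W';C) + Σ_{S ⊆ W', lab(S∪C)=0} t_k(W'∖S)`: erase `x` from its block; if
  the block keeps label `k` the result is a rainbow of `(W';C)`, otherwise the block becomes a bottom spectator `S` and the two other blocks a cross
  pair of `W'∖S` avoiding `k` (both maps injective, images disjoint by construction).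
* `Sunflower.minorSuperadditivity_of_petal` — **(DC) AT A PETAL POINT**: `f(W';C) + f(W';C∪{x}) ≤ f(W;C)`.  With `minorSuperadditivity_of_dominant`
  (`…SunflowerMinorCube`): the typed conjecture `MinorSuperadditivity` holds at every NON-BOTTOM point; the open core of the programme
  (DC) ⇒ (★_B) ⇒ ★ is the case `lab (C ∪ {x}) = 0`.
-/

namespace Summit.CriticalPhenomena.PercolationContinuityZ3.Theorems.SunflowerPartition

open Finset

namespace Sunflower

variable {α : Type*} [Fintype α] [DecidableEq α] (F : Sunflower α)

omit [Fintype α] in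
/-- If `x ∈ T` and `lab (T ∪ C)` is a petal then `lab (C ∪ {x}) ∈ {lab (T ∪ C), 0}`. [this work] -/
theorem lab_insert_of_mem_block {T C : Finset α} {x : α} (hx : x ∈ T) (h4 : F.lab (T ∪ C) ≠ 4) :
    F.lab (insert x C) = F.lab (T ∪ C) ∨ F.lab (insert x C) = 0 := by
  have hsub : insert x C ⊆ T ∪ C := by
    intro z hz; rcases mem_insert.1 hz with rfl | h
    · exact mem_union_left _ hx
    · exact mem_union_right _ h
  exact F.lab_subset hsub h4

omit [Fintype α] in
/-- Membership in `partsOf`. [this work] -/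
theorem mem_partsOf_iff {W : Finset α} {q : Finset α × Finset α} : q ∈ partsOf W ↔ q.1 ⊆ W ∧ q.2 ⊆ W ∧ Disjoint q.1 q.2 := by
  unfold partsOf
  rw [mem_filter, mem_product, mem_powerset, mem_powerset]
  tauto

omit [Fintype α] in
/-- Recovering a block: `(W ∖ A) ∖ (W ∖ (A ∪ B)) = B` for disjoint `A, B ⊆ W`. [folklore] -/
theorem sdiff_sdiff_blocks {W A B : Finset α} (hB : B ⊆ W) (hd : Disjoint A B) :
    (W \ A) \ (W \ (A ∪ B)) = B := by
  ext y
  constructor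
  · intro h
    obtain ⟨h1, hn⟩ := mem_sdiff.1 h
    obtain ⟨hyW, hyA⟩ := mem_sdiff.1 h1
    by_contra hyB
    exact hn (mem_sdiff.2 ⟨hyW, fun hu => (mem_union.1 hu).elim hyA hyB⟩)
  · intro hyB
    refine mem_sdiff.2 ⟨mem_sdiff.2 ⟨hB hyB, fun hyA => (Finset.disjoint_left.1 hd) hyA hyB⟩, fun h => ?_⟩
    exact (mem_sdiff.1 h).2 (mem_union_right _ hyB)

omit [Fintype α] in
/-- Recovering a block: `(W ∖ B) ∖ (W ∖ (A ∪ B)) = A` for disjoint `A, B`, `A ⊆ W`. [folklore] -/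
theorem sdiff_sdiff_blocks' {W A B : Finset α} (hA : A ⊆ W) (hd : Disjoint A B) :
    (W \ B) \ (W \ (A ∪ B)) = A := by
  rw [union_comm]; exact sdiff_sdiff_blocks hA hd.symm

omit [Fintype α] in
/-- Recovering a block: `(A ∪ B) ∖ B = A` for disjoint `A, B`. [folklore] -/
theorem union_sdiff_block {A B : Finset α} (hd : Disjoint A B) : (A ∪ B) \ B = A := by
  ext y
  constructor
  · intro h
    obtain ⟨hu, hn⟩ := mem_sdiff.1 h
    exact (mem_union.1 hu).elim id fun hb => absurd hb hn
  · intro hyA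
    exact mem_sdiff.2 ⟨mem_union_left _ hyA, fun hyB => (Finset.disjoint_left.1 hd) hyA hyB⟩

/-! ## The rainbow injection -/

omit [Fintype α] in
/-- **RAINBOW INJECTION at a petal point** (this work): with `k = lab (C ∪ {x})` a petal and `W' = W ∖ {x}`,
`N(W;C) ≤ N(W';C) + Σ_{S ⊆ W', lab(S∪C)=0} t_k(W'∖S)`, `t_k(U)` = the cross pairs of `U` (labels `·∪C`) avoiding `k`. [this work] -/
theorem minorRainbows_le_petal (W C : Finset α) (x : α) (hx : x ∈ W)
    (hk0 : F.lab (insert x C) ≠ 0) (hk4 : F.lab (insert x C) ≠ 4) :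
    F.minorRainbows W C ≤ F.minorRainbows (W.erase x) C
      + ∑ S ∈ (W.erase x).powerset.filter (fun S => F.lab (S ∪ C) = 0),
          (((W.erase x) \ S).powerset.filter (fun Y =>
            F.lab ((((W.erase x) \ S) \ Y) ∪ C) ≠ 0 ∧ F.lab ((((W.erase x) \ S) \ Y) ∪ C) ≠ 4 ∧
            F.lab ((((W.erase x) \ S) \ Y) ∪ C) ≠ F.lab (insert x C) ∧
            F.lab (Y ∪ C) ≠ 0 ∧ F.lab (Y ∪ C) ≠ 4 ∧ F.lab (Y ∪ C) ≠ F.lab (insert x C) ∧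
            F.lab ((((W.erase x) \ S) \ Y) ∪ C) < F.lab (Y ∪ C))).card := by
  set k := F.lab (insert x C) with hkdef
  set W' := W.erase x with hW'
  have hxW' : x ∉ W' := Finset.notMem_erase x W
  -- the rainbow sets
  set RB := (partsOf W).filter (fun q => F.lab (q.1 ∪ C) = 1 ∧ F.lab (q.2 ∪ C) = 2 ∧ F.lab ((W \ (q.1 ∪ q.2)) ∪ C) = 3) with hRB
  set RB' := (partsOf W').filter (fun q => F.lab (q.1 ∪ C) = 1 ∧ F.lab (q.2 ∪ C) = 2 ∧ F.lab ((W' \ (q.1 ∪ q.2)) ∪ C) = 3) with hRB'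
  set Bd := W'.powerset.filter (fun S => F.lab (S ∪ C) = 0) with hBd
  let tK : Finset α → Finset (Finset α) := fun U => U.powerset.filter (fun Y =>
      F.lab ((U \ Y) ∪ C) ≠ 0 ∧ F.lab ((U \ Y) ∪ C) ≠ 4 ∧ F.lab ((U \ Y) ∪ C) ≠ k ∧
      F.lab (Y ∪ C) ≠ 0 ∧ F.lab (Y ∪ C) ≠ 4 ∧ F.lab (Y ∪ C) ≠ k ∧ F.lab ((U \ Y) ∪ C) < F.lab (Y ∪ C))
  show RB.card ≤ RB'.card + ∑ S ∈ Bd, (tK (W' \ S)).card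
  -- k is a petal
  have hk : k = 1 ∨ k = 2 ∨ k = 3 := by
    have key : ∀ j : Fin 5, j ≠ 0 → j ≠ 4 → j = 1 ∨ j = 2 ∨ j = 3 := by decide
    exact key k hk0 hk4
  -- where is `x`?
  have hx1 : ∀ q ∈ RB, x ∈ q.1 → k = 1 := by
    intro q hq hxq
    have h := (mem_filter.1 hq).2.1
    rcases F.lab_insert_of_mem_block hxq (by rw [h]; decide) with e | e
    · exact e.trans h
    · exact absurd e hk0
  have hx2 : ∀ q ∈ RB, x ∈ q.2 → k = 2 := by
    intro q hq hxq
    have h := (mem_filter.1 hq).2.2.1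
    rcases F.lab_insert_of_mem_block hxq (by rw [h]; decide) with e | e
    · exact e.trans h
    · exact absurd e hk0
  have hx3 : ∀ q ∈ RB, x ∈ W \ (q.1 ∪ q.2) → k = 3 := by
    intro q hq hxq
    have h := (mem_filter.1 hq).2.2.2
    rcases F.lab_insert_of_mem_block hxq (by rw [h]; decide) with e | e
    · exact e.trans h
    · exact absurd e hk0
  -- the erasing map
  let e : Finset α × Finset α → Finset α × Finset α := fun q => (q.1.erase x, q.2.erase x)
  have he_parts : ∀ q ∈ RB, e q ∈ partsOf W' := by
    intro q hq
    obtain ⟨h1, h2, hd⟩ := mem_partsOf_iff.1 (mem_filter.1 hq).1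
    refine mem_partsOf_iff.2 ⟨?_, ?_, ?_⟩
    · intro y hy; rw [mem_erase] at hy; exact mem_erase.2 ⟨hy.1, h1 hy.2⟩
    · intro y hy; rw [mem_erase] at hy; exact mem_erase.2 ⟨hy.1, h2 hy.2⟩
    · exact Finset.disjoint_of_subset_left (erase_subset _ _) (Finset.disjoint_of_subset_right (erase_subset _ _) hd)
  have he3 : ∀ q ∈ RB, W' \ ((e q).1 ∪ (e q).2) = (W \ (q.1 ∪ q.2)).erase x := by
    intro q _
    ext y
    simp only [e, hW', mem_sdiff, mem_erase, mem_union]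
    tauto
  have he_inj : Set.InjOn e (RB : Set (Finset α × Finset α)) := by
    intro q hq r hr hqr
    have hq' := mem_coe.1 hq
    have hr' := mem_coe.1 hr
    simp only [e, Prod.mk.injEq] at hqr
    have key : ∀ (A B : Finset α), (x ∈ A ↔ x ∈ B) → A.erase x = B.erase x → A = B := by
      intro A B hiff hAB
      ext y
      by_cases hy : y = x
      · subst hy; exact hiff
      · constructor
        · intro h; have : y ∈ A.erase x := mem_erase.2 ⟨hy, h⟩; rw [hAB] at this; exact (mem_erase.1 this).2
        · intro h; have : y ∈ B.erase x := mem_erase.2 ⟨hy, h⟩; rw [← hAB] at this; exact (mem_erase.1 this).2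
    -- `x` is in the `k`-block of both
    have hxpos : ∀ s ∈ RB, (x ∈ s.1 ↔ k = 1) ∧ (x ∈ s.2 ↔ k = 2) := by
      intro s hs
      obtain ⟨h1, h2, hd⟩ := mem_partsOf_iff.1 (mem_filter.1 hs).1
      have hcov : x ∈ s.1 ∨ x ∈ s.2 ∨ x ∈ W \ (s.1 ∪ s.2) := by
        by_cases a : x ∈ s.1
        · exact Or.inl a
        by_cases b : x ∈ s.2
        · exact Or.inr (Or.inl b)
        · exact Or.inr (Or.inr (mem_sdiff.2 ⟨hx, by rw [mem_union, not_or]; exact ⟨a, b⟩⟩))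
      refine ⟨⟨hx1 s hs, fun hk1 => ?_⟩, ⟨hx2 s hs, fun hk2 => ?_⟩⟩
      · rcases hcov with h | h | h
        · exact h
        · have := hx2 s hs h; rw [hk1] at this; exact absurd this (by decide)
        · have := hx3 s hs h; rw [hk1] at this; exact absurd this (by decide)
      · rcases hcov with h | h | h
        · have := hx1 s hs h; rw [hk2] at this; exact absurd this (by decide)
        · exact h
        · have := hx3 s hs h; rw [hk2] at this; exact absurd this (by decide)
    have h1 : q.1 = r.1 := key q.1 r.1 (by rw [(hxpos q hq').1, (hxpos r hr').1]) hqr.1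
    have h2 : q.2 = r.2 := key q.2 r.2 (by rw [(hxpos q hq').2, (hxpos r hr').2]) hqr.2
    exact Prod.ext h1 h2
  -- split the rainbows of `(W;C)`
  set A := RB.filter (fun q => e q ∈ RB') with hA
  set B := RB.filter (fun q => ¬ e q ∈ RB') with hB
  have hsplit : RB.card = A.card + B.card := by
    rw [hA, hB]; exact (Finset.card_filter_add_card_filter_not _).symm
  have hAle : A.card ≤ RB'.card := by
    refine Finset.card_le_card_of_injOn e (fun q hq => (mem_filter.1 hq).2) ?_
    exact fun q hq r hr h => he_inj (mem_coe.2 (mem_filter.1 (mem_coe.1 hq)).1) (mem_coe.2 (mem_filter.1 (mem_coe.1 hr)).1) h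
  -- the second map, into the sigma set
  have hBle : B.card ≤ (Bd.sigma fun S => tK (W' \ S)).card := by
    -- blocks: `Tk` = the block containing `x`, `Ti`/`Tj` the two others in increasing label order
    let Tk : Finset α × Finset α → Finset α := fun q => if k = 1 then q.1 else if k = 2 then q.2 else W \ (q.1 ∪ q.2)
    let Tj : Finset α × Finset α → Finset α := fun q => if k = 3 then q.2 else W \ (q.1 ∪ q.2)
    let g : Finset α × Finset α → (Σ _ : Finset α, Finset α) := fun q => ⟨(Tk q).erase x, Tj q⟩
    have hxTk : ∀ s ∈ RB, x ∈ Tk s := by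
      intro s hs
      simp only [Tk]
      rcases hk with h | h | h
      · rw [if_pos h]
        by_contra hx1'
        by_cases b : x ∈ s.2
        · have := hx2 s hs b; rw [h] at this; exact absurd this (by decide)
        · have := hx3 s hs (mem_sdiff.2 ⟨hx, by rw [mem_union, not_or]; exact ⟨hx1', b⟩⟩); rw [h] at this
          exact absurd this (by decide)
      · rw [if_neg (by rw [h]; decide), if_pos h]
        by_contra hx2'
        by_cases a : x ∈ s.1
        · have := hx1 s hs a; rw [h] at this; exact absurd this (by decide)
        · have := hx3 s hs (mem_sdiff.2 ⟨hx, by rw [mem_union, not_or]; exact ⟨a, hx2'⟩⟩); rw [h] at this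
          exact absurd this (by decide)
      · rw [if_neg (by rw [h]; decide), if_neg (by rw [h]; decide)]
        by_contra hx3'
        by_cases a : x ∈ s.1
        · have := hx1 s hs a; rw [h] at this; exact absurd this (by decide)
        · by_cases b : x ∈ s.2
          · have := hx2 s hs b; rw [h] at this; exact absurd this (by decide)
          · exact hx3' (mem_sdiff.2 ⟨hx, by rw [mem_union, not_or]; exact ⟨a, b⟩⟩)
    -- facts about a rainbow `q ∈ B`
    have hfacts : ∀ q ∈ B,
        (Tk q).erase x ∈ Bd ∧ Tj q ∈ tK (W' \ (Tk q).erase x) := by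
      intro q hqB
      obtain ⟨hq, hne⟩ := mem_filter.1 hqB
      obtain ⟨hq1W, hq2W, hdisj⟩ := mem_partsOf_iff.1 (mem_filter.1 hq).1
      obtain ⟨l1, l2, l3⟩ := (mem_filter.1 hq).2
      -- the erased labels: only the `k`-block can change
      have hxk : x ∈ Tk q := hxTk q hq
      have hx1n : k ≠ 1 → x ∉ q.1 := fun hk1 a => hk1 (hx1 q hq a)
      have hx2n : k ≠ 2 → x ∉ q.2 := fun hk2 b => hk2 (hx2 q hq b)
      have hx3n : k ≠ 3 → x ∉ W \ (q.1 ∪ q.2) := fun hk3 c => hk3 (hx3 q hq c)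
      -- label of the erased `k`-block is `0`
      have hTk_lab : F.lab (Tk q ∪ C) = k := by
        simp only [Tk]; rcases hk with h | h | h
        · rw [if_pos h, l1, h]
        · rw [if_neg (by rw [h]; decide), if_pos h, l2, h]
        · rw [if_neg (by rw [h]; decide), if_neg (by rw [h]; decide), l3, h]
      have herase_le : F.lab ((Tk q).erase x ∪ C) = k ∨ F.lab ((Tk q).erase x ∪ C) = 0 := by
        have := F.lab_subset (union_subset_union (erase_subset x (Tk q)) (subset_refl C)) (by rw [hTk_lab]; exact hk4)
        rw [hTk_lab] at this; exact this
      have herase0 : F.lab ((Tk q).erase x ∪ C) = 0 := by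
        rcases herase_le with h | h
        · -- then `e q` would be a rainbow of `(W';C)`
          exfalso; apply hne
          refine mem_filter.2 ⟨he_parts q hq, ?_, ?_, ?_⟩
          · show F.lab (q.1.erase x ∪ C) = 1
            by_cases hk1 : k = 1
            · have : Tk q = q.1 := by simp only [Tk]; rw [if_pos hk1]
              rw [← this, h, hk1]
            · rw [Finset.erase_eq_of_notMem (hx1n hk1), l1]
          · show F.lab (q.2.erase x ∪ C) = 2
            by_cases hk2 : k = 2
            · have : Tk q = q.2 := by simp only [Tk]; rw [if_neg (by rw [hk2]; decide), if_pos hk2]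
              rw [← this, h, hk2]
            · rw [Finset.erase_eq_of_notMem (hx2n hk2), l2]
          · rw [he3 q hq]
            by_cases hk3 : k = 3
            · have : Tk q = W \ (q.1 ∪ q.2) := by
                simp only [Tk]; rw [if_neg (by rw [hk3]; decide), if_neg (by rw [hk3]; decide)]
              rw [← this, h, hk3]
            · rw [Finset.erase_eq_of_notMem (hx3n hk3), l3]
        · exact h
      have hTkW : Tk q ⊆ W := by
        simp only [Tk]; rcases hk with h | h | h
        · rw [if_pos h]; exact hq1W
        · rw [if_neg (by rw [h]; decide), if_pos h]; exact hq2W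
        · rw [if_neg (by rw [h]; decide), if_neg (by rw [h]; decide)]; exact sdiff_subset
      have hSBd : (Tk q).erase x ∈ Bd := by
        refine mem_filter.2 ⟨mem_powerset.2 fun y hy => ?_, herase0⟩
        rw [mem_erase] at hy; exact mem_erase.2 ⟨hy.1, hTkW hy.2⟩
      refine ⟨hSBd, ?_⟩
      -- the cross pair (Ti | Tj) of `W' \ S`
      have hW'S : W' \ (Tk q).erase x = W \ Tk q := by
        ext y; simp only [hW', mem_sdiff, mem_erase]
        constructor
        · rintro ⟨⟨hyx, hyW⟩, hn⟩; exact ⟨hyW, fun hyT => hn ⟨hyx, hyT⟩⟩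
        · rintro ⟨hyW, hyT⟩; refine ⟨⟨fun hyx => hyT (hyx ▸ hxk), hyW⟩, fun h => hyT h.2⟩
      rw [hW'S]
      simp only [tK, Tj]
      rcases hk with h | h | h
      · -- k = 1: Ti = q.2 (label 2), Tj = q3 (label 3)
        have hTk1 : Tk q = q.1 := by simp only [Tk]; rw [if_pos h]
        rw [if_neg (by rw [h]; decide), hTk1]
        have hrest : (W \ q.1) \ (W \ (q.1 ∪ q.2)) = q.2 := sdiff_sdiff_blocks hq2W hdisj
        refine mem_filter.2 ⟨mem_powerset.2 (sdiff_subset_sdiff (subset_refl _) subset_union_left), ?_⟩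
        rw [hrest, l2, l3, h]; decide
      · -- k = 2: Ti = q.1 (label 1), Tj = q3 (label 3)
        have hTk2 : Tk q = q.2 := by simp only [Tk]; rw [if_neg (by rw [h]; decide), if_pos h]
        rw [if_neg (by rw [h]; decide), hTk2]
        have hrest : (W \ q.2) \ (W \ (q.1 ∪ q.2)) = q.1 := sdiff_sdiff_blocks' hq1W hdisj
        refine mem_filter.2 ⟨mem_powerset.2 (sdiff_subset_sdiff (subset_refl _) subset_union_right), ?_⟩
        rw [hrest, l1, l3, h]; decide
      · -- k = 3: Ti = q.1 (label 1), Tj = q.2 (label 2)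
        have hTk3 : Tk q = W \ (q.1 ∪ q.2) := by
          simp only [Tk]; rw [if_neg (by rw [h]; decide), if_neg (by rw [h]; decide)]
        rw [if_pos h, hTk3]
        have hWW : W \ (W \ (q.1 ∪ q.2)) = q.1 ∪ q.2 := by
          rw [Finset.sdiff_sdiff_eq_self (union_subset hq1W hq2W)]
        have hrest : (W \ (W \ (q.1 ∪ q.2))) \ q.2 = q.1 := by rw [hWW]; exact union_sdiff_block hdisj
        refine mem_filter.2 ⟨mem_powerset.2 (by rw [hWW]; exact subset_union_right), ?_⟩
        rw [hrest, l1, l2, h]; decide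
    -- `g` maps `B` into the sigma set, injectively
    refine Finset.card_le_card_of_injOn g (fun q hq => Finset.mem_sigma.2 (hfacts q hq)) ?_
    intro q hq r hr hqr
    have hq' : q ∈ B := mem_coe.1 hq
    have hr' : r ∈ B := mem_coe.1 hr
    have hqRB : q ∈ RB := (mem_filter.1 hq').1
    have hrRB : r ∈ RB := (mem_filter.1 hr').1
    obtain ⟨hq1W, hq2W, hqd⟩ := mem_partsOf_iff.1 (mem_filter.1 hqRB).1
    obtain ⟨hr1W, hr2W, hrd⟩ := mem_partsOf_iff.1 (mem_filter.1 hrRB).1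
    simp only [g, Sigma.mk.injEq, heq_eq_eq] at hqr
    obtain ⟨hS, hY⟩ := hqr
    -- recover `Tk`: both contain `x`
    have hxkq : x ∈ Tk q := hxTk q hqRB
    have hxkr : x ∈ Tk r := hxTk r hrRB
    have hTk : Tk q = Tk r := by
      rw [← Finset.insert_erase hxkq, ← Finset.insert_erase hxkr, hS]
    -- now recover `q.1`, `q.2` in each case
    rcases hk with h | h | h
    · have e1 : q.1 = r.1 := by
        have a : Tk q = q.1 := by simp only [Tk]; rw [if_pos h]
        have b : Tk r = r.1 := by simp only [Tk]; rw [if_pos h]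
        rw [← a, ← b, hTk]
      have hYq : Tj q = W \ (q.1 ∪ q.2) := by simp only [Tj]; rw [if_neg (by rw [h]; decide)]
      have hYr : Tj r = W \ (r.1 ∪ r.2) := by simp only [Tj]; rw [if_neg (by rw [h]; decide)]
      have e2 : q.2 = r.2 := by
        have hq2 : (W \ q.1) \ Tj q = q.2 := by rw [hYq]; exact sdiff_sdiff_blocks hq2W hqd
        have hr2 : (W \ r.1) \ Tj r = r.2 := by rw [hYr]; exact sdiff_sdiff_blocks hr2W hrd
        rw [← hq2, ← hr2, e1, hY]
      exact Prod.ext e1 e2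
    · have e2 : q.2 = r.2 := by
        have a : Tk q = q.2 := by simp only [Tk]; rw [if_neg (by rw [h]; decide), if_pos h]
        have b : Tk r = r.2 := by simp only [Tk]; rw [if_neg (by rw [h]; decide), if_pos h]
        rw [← a, ← b, hTk]
      have hYq : Tj q = W \ (q.1 ∪ q.2) := by simp only [Tj]; rw [if_neg (by rw [h]; decide)]
      have hYr : Tj r = W \ (r.1 ∪ r.2) := by simp only [Tj]; rw [if_neg (by rw [h]; decide)]
      have e1 : q.1 = r.1 := by
        have hq1 : (W \ q.2) \ Tj q = q.1 := by rw [hYq]; exact sdiff_sdiff_blocks' hq1W hqd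
        have hr1 : (W \ r.2) \ Tj r = r.1 := by rw [hYr]; exact sdiff_sdiff_blocks' hr1W hrd
        rw [← hq1, ← hr1, e2, hY]
      exact Prod.ext e1 e2
    · have hYq : Tj q = q.2 := by simp only [Tj]; rw [if_pos h]
      have hYr : Tj r = r.2 := by simp only [Tj]; rw [if_pos h]
      have e2 : q.2 = r.2 := by rw [← hYq, ← hYr, hY]
      have a : Tk q = W \ (q.1 ∪ q.2) := by simp only [Tk]; rw [if_neg (by rw [h]; decide), if_neg (by rw [h]; decide)]
      have b : Tk r = W \ (r.1 ∪ r.2) := by simp only [Tk]; rw [if_neg (by rw [h]; decide), if_neg (by rw [h]; decide)]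
      have e1 : q.1 = r.1 := by
        have hq1 : (W \ Tk q) \ q.2 = q.1 := by
          rw [a, Finset.sdiff_sdiff_eq_self (union_subset hq1W hq2W)]; exact union_sdiff_block hqd
        have hr1 : (W \ Tk r) \ r.2 = r.1 := by
          rw [b, Finset.sdiff_sdiff_eq_self (union_subset hr1W hr2W)]; exact union_sdiff_block hrd
        rw [← hq1, ← hr1, hTk, e2]
      exact Prod.ext e1 e2
  rw [Finset.card_sigma] at hBle
  omega

/-! ## (DC) at a petal point -/

omit [Fintype α] in
/-- **(DC) AT A PETAL POINT** (this work): if `k = lab (C ∪ {x})` is a petal (`k ∉ {0,4}`) then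
`f(W∖x; C) + f(W∖x; C ∪ {x}) ≤ f(W; C)`. [this work] -/
theorem minorSuperadditivity_of_petal (W C : Finset α) (x : α) (hx : x ∈ W)
    (hk0 : F.lab (insert x C) ≠ 0) (hk4 : F.lab (insert x C) ≠ 4) :
    F.minorSlack (W.erase x) C + F.minorSlack (W.erase x) (insert x C) ≤ F.minorSlack W C := by
  set W' := W.erase x with hW'
  have hxW' : x ∉ W' := Finset.notMem_erase x W
  have hWins : W = insert x W' := by rw [hW', Finset.insert_erase hx]
  rw [F.minorSlack_eq_zero_of_lab_ne_zero W' (insert x C) hk0, add_zero]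
  have hR := F.minorRainbows_le_petal W C x hx hk0 hk4
  unfold minorSlack
  rw [F.minorBottoms_eq_of_lab_insert_ne_zero W C x hk0]
  rw [← hW']
  -- compare cube by cube
  have hcube : ∀ S ∈ W'.powerset.filter (fun S => F.lab (S ∪ C) = 0),
      ((F.minorAB C (W' \ S) : ℤ) - F.minorCR C (W' \ S))
        + (((W' \ S).powerset.filter (fun Y =>
            F.lab ((((W' \ S)) \ Y) ∪ C) ≠ 0 ∧ F.lab (((W' \ S) \ Y) ∪ C) ≠ 4 ∧ F.lab (((W' \ S) \ Y) ∪ C) ≠ F.lab (insert x C) ∧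
            F.lab (Y ∪ C) ≠ 0 ∧ F.lab (Y ∪ C) ≠ 4 ∧ F.lab (Y ∪ C) ≠ F.lab (insert x C) ∧
            F.lab (((W' \ S) \ Y) ∪ C) < F.lab (Y ∪ C))).card : ℤ)
      ≤ (F.minorAB C (W \ S) : ℤ) - F.minorCR C (W \ S) := by
    intro S hS
    have hSW' : S ⊆ W' := mem_powerset.1 (mem_filter.1 hS).1
    have hxS : x ∉ S := fun h => hxW' (hSW' h)
    have hWS : W \ S = insert x (W' \ S) := by rw [hWins, Finset.insert_sdiff_of_notMem _ hxS]
    rw [hWS]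
    exact F.minorCube_petal C (W' \ S) x (fun h => hxW' (mem_sdiff.1 h).1) hk0 hk4
  have hsum := Finset.sum_le_sum hcube
  rw [Finset.sum_add_distrib] at hsum
  have hRz : (F.minorRainbows W C : ℤ) ≤ (F.minorRainbows W' C : ℤ)
      + ∑ S ∈ W'.powerset.filter (fun S => F.lab (S ∪ C) = 0),
          ((((W' \ S).powerset.filter (fun Y =>
            F.lab ((((W' \ S)) \ Y) ∪ C) ≠ 0 ∧ F.lab (((W' \ S) \ Y) ∪ C) ≠ 4 ∧ F.lab (((W' \ S) \ Y) ∪ C) ≠ F.lab (insert x C) ∧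
            F.lab (Y ∪ C) ≠ 0 ∧ F.lab (Y ∪ C) ≠ 4 ∧ F.lab (Y ∪ C) ≠ F.lab (insert x C) ∧
            F.lab (((W' \ S) \ Y) ∪ C) < F.lab (Y ∪ C))).card : ℤ)) := by
    exact_mod_cast hR
  linarith

end Sunflower

end Summit.CriticalPhenomena.PercolationContinuityZ3.Theorems.SunflowerPartition
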